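import Summits.QuantumFields.BalabanUV.Beta.HessKerRootedWall
import Summits.QuantumFields.BalabanUV.Beta.AxialDressingRootedHessian

/-!
# `BalabanUV.Beta.HessKerCoDressedWall` — the road-A2 END over the rooted literal `SpineRooted.JsBalAtOf` and over the wall candidate
# v2.22 `SpineRooted.JsBalAn1At hLc hr`, RE-SOCKETED ON THE CO-DRESSED RESOLVENTS `Π_ρ K_j Πᵀ_ρ` (asymptotic lane asym1, gen 18, v1; the
# consumer side of exit R8(ii) of lane G-an2-4 part P3's obstruction census)

HONEST FRAMING (cell contract, verbatim): «discharging `BetaPertH` makes Bałaban's UV stability UNCONDITIONAL — a real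
constructive-QFT result; it is NOT the continuum limit and NOT the Clay problem.»  THIS MODULE re-types the K-SLOT of the wall's END
(`HessKerRootedWall.d1Drift_JsBalAn1At_iff_of_cauchy_unit`, gen 17): there the resolvent rows are asked ENTRYWISE of the rescaled decimated
weak-Landau resolvents `D_j K_j D_j`, `K_j = KInvStep Lc j`, and the stencil / table rows are moved through the rooted dressing `𝔇_ρ`.  Lane
G-an2-4 part P3 (Woodbury–fibre census) located the obstruction to such entrywise K-rows for Bałaban's objects at the `N`-dependent weak-Landau
gauge slice (an5's recorded failure of the entrywise covariance telescoping `ResolventComposition.K1aNeg` against the proved transverse form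
`K1aTrans`) and recommended re-typing the binders modulo residual gauge (exit R8(ii)).  an2's DRESSED-KERNEL IDENTITY
`AxialDressingRootedHessian.TbalOf_dressAt` reads every member of the rooted family as `hessKer G_j (vertexOfK G_j Lc (JsBal0AtOf … j).S)
((JsBal0AtOf … j).W)` with the CO-DRESSED resolvent `G_j := AxialDressingRooted.coDressKAt (toSite r) Lc (KInvStep Lc j)` (`= Π_ρ K_j Πᵀ_ρ`, the
rooted comb projector on both field legs) and the UNDRESSED jets; hence (part 1's four-family END `HessKerFourFamily.d1Drift_iff_of_cauchy_four` at
that closed form) the wall is equivalent to the explicit identification under rows asked of `D_j G_j D_j` and of the UNDRESSED rescaled stencils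
and tables (§3–§4).  `Π_ρ` annihilates the RESIDUAL pure gauges (gradients of functions vanishing at the block base points,
`AxialProjector.axProj_grad_eq_zero`) on both field legs, so the new K-rows forgive every such `j`-dependence of `K_j`; they do NOT forgive coarse
pure gauges (`AxialProjector.axProj_grad_of_blockConst`).  Whether Bałaban's `G_j` satisfy them is OPEN (cell journal Q-dress; if the coarse part
of the gauge-slice defect does not converge, exit R8(i)'s Ward lemma is needed ON TOP of this socket).  This module formalises NO statement
printed in Bałaban's papers, cites none as a hypothesis, mints no `Prop` fact, instantiates NO binder of the wall at a value (RULING (R18-3):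
root offset, colour weights, position table, tables, localisation data, unit sequences and every constant stay UNIVERSALLY BOUND) and
DISCHARGES NOTHING of it.  NOT summit progress.

ABSOLUTE RULE (cell, verbatim): «No internally-minted statement may enter as a cited fact. Every hypothesis is either
kernel-proved in this package or a verbatim quotation of a PUBLISHED theorem with page reference. The manuscript(s) under
audit are NOT citable for their own disputed steps — they are the thing under adjudication; programme-internal
(2001/route/tribunal) claims are never citable.»  The data binders below are HYPOTHESIS SHAPES with free constants, never asserted.

PLACEMENT.  Cell result under the registered topic `Summits/QuantumFields/BalabanUV/Beta/` (β-lead (R34-2); < 400 lines; theorems only).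

CONTENT (no `def`, no `Prop`; every constant explicit or uniform-existential in `(d, N, δ)` only).
* §1 (any `d`, any root table): `piK ρ N` is block-diagonal in the leg type, so LEG-TYPE-CONSTANT UNITS COMMUTE WITH THE CO-DRESSING:
  `scaleK_piK`, `scaleK_trK_piK`, **`unitK_coDressKAt`** (`D (Π_ρ K Πᵀ_ρ) D = Π_ρ (D K D) Πᵀ_ρ`, nonzero units; `HessKerRate.comp_scaleK`).
* §2 (any `d`, in-block root): **`coDressKAt_sub`** (additivity on spread kernels), **`exists_decays_coDressKAt`** (a constant `c(d,N,δ) ≥ 0`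
  with `Decays K C δ → Decays (Π_ρ K Πᵀ_ρ) (c·C) (δ/4)` for ALL `K`, `C` — an2's `decays_coDressKAt` with the constant made uniform),
  **`exists_coDressed_rows`**, **`exists_coDressed_unit_rows`**: `j`-uniform rows and all-scales deviations of a (rescaled) resolvent family
  transfer to its (rescaled) co-dressed family at `(c·C, δ/4, c·c_K, θ)` — the co-dressed K-binders of §3–§4 are IMPLIED by the entrywise ones
  of `HessKerRootedWall` (weaker-or-equal; strictly weaker for Bałaban's objects is Q-dress).
* §3 (`d = 3`, any in-block root, any tables): **`TbalOf_JsBalAtOf_codressed`** (an2's identity on a presentation `S♭` of the undressed stencils),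
  **`TbalOf_JsBalAtOf_codressed_unit`** (any leg units: part 1's `hessKer_four_unit`), **`d1Drift_JsBalAtOf_iff_of_lim_codressed_unit`**,
  **`d1Drift_JsBalAtOf_iff_of_cauchy_codressed_unit`**: binder list = `j`-uniform rows + deviations with rate `θ` of `D_j G_j D_j`, of the
  UNDRESSED rescaled rooted stencils `unitS_j (S♭ j)`, of the UNDRESSED rescaled tables `unitW_j (W j)`, windows `0 < R < δK`, `R/2 < δS`,
  `R < δW`, `0 ≤ θ < 1`; conclusion `D1Drift Lc (JsBalAtOf …) N μ ν ↔ secondMoment (hessKer G∞ (vertexOfK G∞ Lc S∞) W∞) μ ν = stepBal N Lc`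
  (NO dressing in the limit objects).
* §4 v2.22: **`d1Drift_JsBalAn1At_iff_of_cauchy_codressed_unit`**, `d1Drift_JsBalAn1At_of_cauchy_eq_codressed_unit` ((⇐)).
* §5 CONSISTENCY: **`d1Drift_JsBalAn1At_iff_codressed_of_unit_rows`** (gen 17's entrywise binders with window `R < δK/4` already give the
  co-dressed identification), `codressed_eq_iff_dressed_eq_of_unit_rows` (under them the two constructed identifications are equivalent).
WHAT IS NOT HERE: any row for Bałaban's objects; the residual-vs-coarse decomposition of the gauge-slice defect (Q-dress); a Ward lemma for coarse
pure gauges; the identification of the limit second moment with `stepBal N Lc` (O-asym1-7); `k₀`; `betaPertH_holds`.  NOT continuum, NOT Clay.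
Provenance: pub-balaban β sub-cell, unit b2b-balaban-beta-asym1 gen 18, 2026-08-19 (v1); over an2's `AxialDressingRooted{Kernel,Linear,Hessian}`
(gen 12) and asym1's `HessKerFourFamily` / `HessKerRootedWall` (gen 17) BY NAME; no existing file touched.
-/


open Finset Filter Topology
open scoped BigOperators
open Literature.MathematicalPhysics.QuantumFieldTheory.Balaban1983to89
open Literature.MathematicalPhysics.QuantumFieldTheory.Balaban1983to89.Beta
open ExpKernelCalculus (MKer Decays BiLoc VertexFamily₂ hessKer comp Zl Zl_nonneg)
open HessKerRate (scaleK scaleK_apply comp_scaleK)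
open AffineAveraging (Form1 box toSite)
open OneStepResolventKernel (Fib LocStencil JetData)
open OneStepKernelFamily (vertexOfK KInvStep TbalOf D1Drift)
open HessKerDressedLimit (limMKerOf limStOf limTabOf decays_limMKerOf decays_sub_limMKerOf locStencil_limStOf locStencil_sub_limStOf
  vertexFamily₂_limTabOf vertexFamily₂_sub_limTabOf)
open Summit.QuantumFields.BalabanUV.Beta.TameKernelCalculus (Spr trK trK_apply decays_trK comp_sub_right_tame comp_sub_left_tame)
open Summit.QuantumFields.BalabanUV.Beta.HessKerDressedUnits
open Summit.QuantumFields.BalabanUV.Beta.HessKerFourFamily (hessKer_four_unit d1Drift_iff_of_lim_four)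
open Summit.QuantumFields.BalabanUV.Beta.AxialDressingRooted (piK piK_inl_inl piK_inl_inr piK_inr_inl piK_inr_inr cP cP_nonneg decays_piK
  spr_piK spr_trK_piK spr_comp coDressKAt coDressKAt_eq dressKAt coProjAtK TbalOf_dressAt)
open Summit.QuantumFields.BalabanUV.Beta.SpineRooted (JsBal0AtOf JsBalAtOf JsBal0AtOf_W JsBalAn1At WbalAtOf T2AtOf T2AtOf_loc CwAtOf δwAtOf
  δwAtOf_pos WbalAtOf_loc₂)
open Summit.QuantumFields.BalabanUV.Beta.HessKerRootedWall (JsBal0AtOf_S_indep JsBalAn1At_eq_JsBalAtOf d1Drift_JsBalAn1At_iff_of_cauchy_unit)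
open AveragingMixedJetTables (vh₂SAt mixFFAt)
open Summit.QuantumFields.BalabanUV.Beta.MixedJetTablesPlug (hB_an1 hmix_an1)

namespace Summit.QuantumFields.BalabanUV.Beta.HessKerCoDressedWall

noncomputable section

/-! ## §1 Leg-type-constant units commute with the co-dressing -/

section Units

variable {d : ℕ} (ρ : Fin (d + 1) → ℤ) (N : ℕ) {sf sm : ℝ}

/-- [folklore] The projector kernel is block-diagonal in the leg type, so `D⁻¹ · piK · D = piK` for leg-type-constant units `D = diag(s_f ∣ s_m)`. -/
theorem scaleK_piK (hsf : sf ≠ 0) (hsm : sm ≠ 0) :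
    scaleK (legScale sf⁻¹ sm⁻¹) (legScale sf sm) (piK ρ N) = piK ρ N := by
  funext x x' a b
  rcases a with α | m <;> rcases b with β | m'
  · rw [scaleK_apply, legScale_inl, legScale_inl, mul_comm, ← mul_assoc, mul_inv_cancel₀ hsf, one_mul]
  · rw [scaleK_apply, piK_inl_inr, mul_zero, zero_mul]
  · rw [scaleK_apply, piK_inr_inl, mul_zero, zero_mul]
  · rw [scaleK_apply, legScale_inr, legScale_inr, mul_comm, ← mul_assoc, mul_inv_cancel₀ hsm, one_mul]

/-- [folklore] … and `D · piKᵀ · D⁻¹ = piKᵀ`. -/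
theorem scaleK_trK_piK (hsf : sf ≠ 0) (hsm : sm ≠ 0) :
    scaleK (legScale sf sm) (legScale sf⁻¹ sm⁻¹) (trK (piK ρ N)) = trK (piK ρ N) := by
  funext x x' a b
  rcases a with α | m <;> rcases b with β | m'
  · rw [scaleK_apply, trK_apply, legScale_inl, legScale_inl, mul_comm, ← mul_assoc, inv_mul_cancel₀ hsf, one_mul]
  · rw [scaleK_apply, trK_apply, piK_inr_inl, mul_zero, zero_mul]
  · rw [scaleK_apply, trK_apply, piK_inl_inr, mul_zero, zero_mul]
  · rw [scaleK_apply, trK_apply, legScale_inr, legScale_inr, mul_comm, ← mul_assoc, inv_mul_cancel₀ hsm, one_mul]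

/-- [folklore] **LEG UNITS COMMUTE WITH THE CO-DRESSING**: `unitK s_f s_m (coDressKAt ρ N K) = coDressKAt ρ N (unitK s_f s_m K)`, i.e.
`D (Π_ρ K Πᵀ_ρ) D = Π_ρ (D K D) Πᵀ_ρ` for nonzero leg-type-constant units (`HessKerRate.comp_scaleK` twice: the inner units cancel). -/
theorem unitK_coDressKAt (hsf : sf ≠ 0) (hsm : sm ≠ 0) (K : MKer (d + 1) (Fib d)) :
    unitK sf sm (coDressKAt ρ N K) = coDressKAt ρ N (unitK sf sm K) := by
  have hinv : ∀ f : Fib d, legScale sf⁻¹ sm⁻¹ f * legScale sf sm f = 1 := legScale_inv_mul_legScale hsf hsm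
  have hmul : ∀ f : Fib d, legScale sf sm f * legScale sf⁻¹ sm⁻¹ f = 1 := legScale_mul_legScale_inv hsf hsm
  rw [coDressKAt_eq, coDressKAt_eq]
  show scaleK (legScale sf sm) (legScale sf sm) (comp (comp (trK (piK ρ N)) K) (piK ρ N)) =
    comp (comp (trK (piK ρ N)) (scaleK (legScale sf sm) (legScale sf sm) K)) (piK ρ N)
  symm
  calc comp (comp (trK (piK ρ N)) (scaleK (legScale sf sm) (legScale sf sm) K)) (piK ρ N)
      = comp (comp (scaleK (legScale sf sm) (legScale sf⁻¹ sm⁻¹) (trK (piK ρ N))) (scaleK (legScale sf sm) (legScale sf sm) K))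
          (scaleK (legScale sf⁻¹ sm⁻¹) (legScale sf sm) (piK ρ N)) := by rw [scaleK_trK_piK ρ N hsf hsm, scaleK_piK ρ N hsf hsm]
    _ = comp (scaleK (legScale sf sm) (legScale sf sm) (comp (trK (piK ρ N)) K)) (scaleK (legScale sf⁻¹ sm⁻¹) (legScale sf sm) (piK ρ N)) := by
          rw [comp_scaleK _ _ _ _ hinv]
    _ = scaleK (legScale sf sm) (legScale sf sm) (comp (comp (trK (piK ρ N)) K) (piK ρ N)) := comp_scaleK _ _ _ _ hmul _ _

end Units

/-! ## §2 Additivity and an explicit-uniform decay transport for the co-dressing; family rows transfer -/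

section Transport

variable {d : ℕ} {N : ℕ} (hN : 1 ≤ N) {r : Fin (d + 1) → ℕ} (hr : r ∈ box (d + 1) N)
include hN hr

/-- [folklore] **THE CO-DRESSING IS ADDITIVE ON SPREAD KERNELS** (in-block root): `Π_ρ (K − K′) Πᵀ_ρ = Π_ρ K Πᵀ_ρ − Π_ρ K′ Πᵀ_ρ`
(an5's tame composition calculus; the series converge absolutely). -/
theorem coDressKAt_sub {K K' : MKer (d + 1) (Fib d)} (hK : Spr K) (hK' : Spr K') :
    coDressKAt (toSite r) N (K - K') = coDressKAt (toSite r) N K - coDressKAt (toSite r) N K' := by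
  have sPt : Spr (trK (piK (toSite r) N)) := spr_trK_piK hN hr
  have sP : Spr (piK (toSite r) N) := spr_piK hN hr
  rw [coDressKAt_eq, coDressKAt_eq, coDressKAt_eq, comp_sub_right_tame sPt.tame hK.tame hK'.tame,
    comp_sub_left_tame (spr_comp sPt hK).tame (spr_comp sPt hK').tame sP.tame]

/-- [folklore] **EXPLICIT-UNIFORM DECAY TRANSPORT THROUGH THE CO-DRESSING**: for every rate `δ > 0` there is a constant `c = c(d, N, δ) ≥ 0`
(namely `|Fib d|²·cP(δ)·cP(δ/2)·Zl(δ/2)·Zl(δ/4)`) with `Decays K C δ → Decays (Π_ρ K Πᵀ_ρ) (c·C) (δ/4)` for ALL kernels `K` and constants `C`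
(`decays_piK` at every rate, `BalabanStepJetsSucc.decays_comp` twice — an2's `decays_coDressKAt` with the constant made uniform in `K`, `C`). -/
theorem exists_decays_coDressKAt {δ : ℝ} (hδ : 0 < δ) :
    ∃ c : ℝ, 0 ≤ c ∧ ∀ (K : MKer (d + 1) (Fib d)) (C : ℝ), Decays K C δ → Decays (coDressKAt (toSite r) N K) (c * C) (δ / 4) := by
  refine ⟨(Fintype.card (Fib d) : ℝ) ^ 2 * (cP d N δ * cP d N (δ / 2)) * (Zl (d + 1) (δ / 2) * Zl (d + 1) (δ / 4)),
    mul_nonneg (mul_nonneg (pow_nonneg (Nat.cast_nonneg _) 2) (mul_nonneg (cP_nonneg d N δ) (cP_nonneg d N (δ / 2))))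
      (mul_nonneg (Zl_nonneg (by linarith)) (Zl_nonneg (by linarith))), fun K C hK => ?_⟩
  have hPt : Decays (trK (piK (toSite r) N)) (cP d N δ) δ := decays_trK (decays_piK hN hr hδ.le)
  have h1 := BalabanStepJetsSucc.decays_comp hPt hK (show (0 : ℝ) ≤ δ / 2 by linarith) (show δ / 2 < δ by linarith)
  rw [show δ - δ / 2 = δ / 2 by ring] at h1
  have hP : Decays (piK (toSite r) N) (cP d N (δ / 2)) (δ / 2) := decays_piK hN hr (by linarith)
  have h2 := BalabanStepJetsSucc.decays_comp h1 hP (show (0 : ℝ) ≤ δ / 4 by linarith) (show δ / 4 < δ / 2 by linarith)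
  rw [show δ / 2 - δ / 4 = δ / 4 by ring] at h2
  rw [coDressKAt_eq]
  exact OneStepResolventKernel.decays_mono h2 (h2.nonneg (Sum.inl 0)) (le_of_eq (by ring)) le_rfl

/-- [folklore] **FAMILY ROWS TRANSFER TO THE CO-DRESSED FAMILY, CAUCHY CURRENCY**: `j`-uniform rows `Decays (K j) C δK` and all-scales deviations
`Decays (K (k+j) − K k) (c_K θ^k) δK` (`δK > 0`) give the same rows for `j ↦ Π_ρ K_j Πᵀ_ρ` at `(c·C, δK/4)` and `(c·c_K·θ^k, δK/4)`, `c = c(d,N,δK)`. -/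
theorem exists_coDressed_rows {K : ℕ → MKer (d + 1) (Fib d)} {C cK δK θ : ℝ} (hδK : 0 < δK) (hK : ∀ j, Decays (K j) C δK)
    (hKall : ∀ k j, Decays (K (k + j) - K k) (cK * θ ^ k) δK) :
    ∃ c : ℝ, 0 ≤ c ∧ (∀ j, Decays (coDressKAt (toSite r) N (K j)) (c * C) (δK / 4)) ∧
      ∀ k j, Decays (coDressKAt (toSite r) N (K (k + j)) - coDressKAt (toSite r) N (K k)) (c * cK * θ ^ k) (δK / 4) := by
  obtain ⟨c, hc0, hc⟩ := exists_decays_coDressKAt hN hr hδK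
  refine ⟨c, hc0, fun j => hc _ _ (hK j), fun k j => ?_⟩
  rw [← coDressKAt_sub hN hr ⟨C, δK, hδK, hK (k + j)⟩ ⟨C, δK, hδK, hK k⟩, mul_assoc]
  exact hc _ _ (hKall k j)

/-- [folklore] **RESCALED FAMILY ROWS TRANSFER TO THE RESCALED CO-DRESSED FAMILY** (nonzero leg units, `unitK_coDressKAt`): rows and all-scales
deviations of `D_j K_j D_j` give those of `D_j (Π_ρ K_j Πᵀ_ρ) D_j` at `(c·C, δK/4, c·c_K, θ)`. -/
theorem exists_coDressed_unit_rows (sf sm : ℕ → ℝ) (hsf : ∀ j, sf j ≠ 0) (hsm : ∀ j, sm j ≠ 0) {K : ℕ → MKer (d + 1) (Fib d)}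
    {C cK δK θ : ℝ} (hδK : 0 < δK) (hK : ∀ j, Decays (unitK (sf j) (sm j) (K j)) C δK)
    (hKall : ∀ k j, Decays (unitK (sf (k + j)) (sm (k + j)) (K (k + j)) - unitK (sf k) (sm k) (K k)) (cK * θ ^ k) δK) :
    ∃ c : ℝ, 0 ≤ c ∧ (∀ j, Decays (unitK (sf j) (sm j) (coDressKAt (toSite r) N (K j))) (c * C) (δK / 4)) ∧
      ∀ k j, Decays (unitK (sf (k + j)) (sm (k + j)) (coDressKAt (toSite r) N (K (k + j))) -
        unitK (sf k) (sm k) (coDressKAt (toSite r) N (K k))) (c * cK * θ ^ k) (δK / 4) := by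
  obtain ⟨c, hc0, h1, h2⟩ := exists_coDressed_rows hN hr (K := fun j => unitK (sf j) (sm j) (K j)) hδK hK hKall
  refine ⟨c, hc0, fun j => ?_, fun k j => ?_⟩
  · rw [unitK_coDressKAt _ _ (hsf j) (hsm j)]
    exact h1 j
  · rw [unitK_coDressKAt _ _ (hsf (k + j)) (hsm (k + j)), unitK_coDressKAt _ _ (hsf k) (hsm k)]
    exact h2 k j

end Transport

/-! ## §3 Dimension four: the END over the rooted literal `SpineRooted.JsBalAtOf` on the CO-DRESSED resolvents, any in-block root, any units -/

section End

variable {Lc : ℕ} [NeZero Lc] (hLc : 1 ≤ Lc) {r : Fin (3 + 1) → ℕ} (hr : r ∈ box (3 + 1) Lc) (cE cVH cΛ : ℝ)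
  (W : ℕ → Fin (3 + 1) → (Fin (3 + 1) → ℤ) → Fin (3 + 1) → (Fin (3 + 1) → ℤ) → MKer (3 + 1) (Fib 3))
  (Cw' δw : ℕ → ℝ) (hδw : ∀ j, 0 < δw j) (hW' : ∀ j, VertexFamily₂ (W j) Lc (Cw' j) (δw j))
  (Sfl : ℕ → Fin (3 + 1) → (Fin (3 + 1) → ℤ) → MKer (3 + 1) (Fib 3)) (sf sm : ℕ → ℝ)
  {Ginf : MKer (3 + 1) (Fib 3)} {Sinf : Fin (3 + 1) → (Fin (3 + 1) → ℤ) → MKer (3 + 1) (Fib 3)}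
  {Winf : Fin (3 + 1) → (Fin (3 + 1) → ℤ) → Fin (3 + 1) → (Fin (3 + 1) → ℤ) → MKer (3 + 1) (Fib 3)}
  {R C cK δK Cs cS δS Cw cW δW θ : ℝ}

/-- [folklore] **an2's DRESSED-KERNEL IDENTITY ON A PRESENTATION OF THE UNDRESSED STENCILS**: for any `S♭` with `hS♭ : ∀ j, (JsBal0AtOf … j).S = S♭ j`,
`TbalOf Lc (JsBalAtOf …) j = hessKer G_j (vertexOfK G_j Lc (S♭ j)) (W j)`, `G_j = coDressKAt (toSite r) Lc (KInvStep Lc j)`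
(`AxialDressingRootedHessian.TbalOf_dressAt`, `JsBalAtOf … = dressAt hr ∘ JsBal0AtOf …` by `rfl`, `JsBal0AtOf_W`). -/
theorem TbalOf_JsBalAtOf_codressed (hSfl : ∀ j, (JsBal0AtOf hLc hr cE cVH cΛ W Cw' δw hδw hW' j).S = Sfl j) (j : ℕ) :
    TbalOf Lc (JsBalAtOf hLc hr cE cVH cΛ W Cw' δw hδw hW') j =
      hessKer (coDressKAt (toSite r) Lc (KInvStep (d := 3) Lc j))
        (vertexOfK (coDressKAt (toSite r) Lc (KInvStep (d := 3) Lc j)) Lc (Sfl j)) (W j) := by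
  have h := TbalOf_dressAt hr (JsBal0AtOf hLc hr cE cVH cΛ W Cw' δw hδw hW') j
  rw [hSfl j, JsBal0AtOf_W] at h; exact h

/-- [folklore] **THE WALL'S MEMBER OVER THE ROOTED LITERAL, IN ANY LEG UNITS, AS A FOUR-FAMILY FORM ON THE CO-DRESSED RESOLVENTS**: for nonzero
`s_f j, s_m j`, `TbalOf Lc (JsBalAtOf …) j = hessKer (D_j G_j D_j) (vertexOfK (D_j G_j D_j) Lc (unitS_j (S♭ j))) (unitW_j (W j))`
(part 1's `hessKer_four_unit`).  NO dressing of the rescaled stencils / tables. -/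
theorem TbalOf_JsBalAtOf_codressed_unit (hSfl : ∀ j, (JsBal0AtOf hLc hr cE cVH cΛ W Cw' δw hδw hW' j).S = Sfl j)
    (hsf : ∀ j, sf j ≠ 0) (hsm : ∀ j, sm j ≠ 0) (j : ℕ) :
    TbalOf Lc (JsBalAtOf hLc hr cE cVH cΛ W Cw' δw hδw hW') j =
      hessKer (unitK (sf j) (sm j) (coDressKAt (toSite r) Lc (KInvStep (d := 3) Lc j)))
        (vertexOfK (unitK (sf j) (sm j) (coDressKAt (toSite r) Lc (KInvStep (d := 3) Lc j))) Lc (unitS (sf j) (sm j) (Sfl j)))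
        (unitW (sf j) (sm j) (W j)) := by
  rw [TbalOf_JsBalAtOf_codressed hLc hr cE cVH cΛ W Cw' δw hδw hW' Sfl hSfl j]
  exact (hessKer_four_unit (hsf j) (hsm j) Lc _ _ (Sfl j) (W j)).symm

/-- [folklore] **THE WALL OVER THE ROOTED LITERAL ⟺ THE EXPLICIT IDENTIFICATION, LIMIT CURRENCY, CO-DRESSED K-SLOT, ANY UNITS**: `j`-uniform
pointwise rows and deviations with rate `θ` of the RESCALED CO-DRESSED RESOLVENTS `D_j G_j D_j`, of the UNDRESSED rescaled rooted stencils
`unitS_j (S♭ j)` and of the UNDRESSED rescaled tables `unitW_j (W j)` against named limits `(G∞, S∞, W∞)`, and `0 ≤ θ < 1` ⟹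
`D1Drift Lc (JsBalAtOf …) N μ ν ↔ secondMoment (hessKer G∞ (vertexOfK G∞ Lc S∞) W∞) μ ν = stepBal N Lc`.  Discharges NOTHING. -/
theorem d1Drift_JsBalAtOf_iff_of_lim_codressed_unit (hSfl : ∀ j, (JsBal0AtOf hLc hr cE cVH cΛ W Cw' δw hδw hW' j).S = Sfl j)
    (hsf : ∀ j, sf j ≠ 0) (hsm : ∀ j, sm j ≠ 0)
    (hG : ∀ j, Decays (unitK (sf j) (sm j) (coDressKAt (toSite r) Lc (KInvStep (d := 3) Lc j))) C δK) (hGinf : Decays Ginf C δK)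
    (hGrate : ∀ j, Decays (unitK (sf j) (sm j) (coDressKAt (toSite r) Lc (KInvStep (d := 3) Lc j)) - Ginf) (cK * θ ^ j) δK)
    (hS : ∀ j, LocStencil (unitS (sf j) (sm j) (Sfl j)) Cs δS) (hSinf : LocStencil Sinf Cs δS)
    (hSrate : ∀ j, LocStencil (unitS (sf j) (sm j) (Sfl j) - Sinf) (cS * θ ^ j) δS)
    (hW : ∀ j, VertexFamily₂ (unitW (sf j) (sm j) (W j)) Lc Cw δW) (hWinf : VertexFamily₂ Winf Lc Cw δW)
    (hWrate : ∀ j, VertexFamily₂ (unitW (sf j) (sm j) (W j) - Winf) Lc (cW * θ ^ j) δW)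
    (hR : 0 < R) (hRK : R < δK) (hRS : R / 2 < δS) (hRW : R < δW) (hθ0 : 0 ≤ θ) (hθ1 : θ < 1) (μ ν : Fin 4) (N : ℝ) :
    D1Drift Lc (JsBalAtOf hLc hr cE cVH cΛ W Cw' δw hδw hW') N μ ν ↔
      B12Beta.secondMoment (hessKer Ginf (vertexOfK Ginf Lc Sinf) Winf) μ ν = B12Normalization.stepBal N Lc :=
  d1Drift_iff_of_lim_four (JsBalAtOf hLc hr cE cVH cΛ W Cw' δw hδw hW')
    (A := fun j => unitK (sf j) (sm j) (coDressKAt (toSite r) Lc (KInvStep (d := 3) Lc j)))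
    (K := fun j => unitK (sf j) (sm j) (coDressKAt (toSite r) Lc (KInvStep (d := 3) Lc j)))
    (S := fun j => unitS (sf j) (sm j) (Sfl j)) (W := fun j => unitW (sf j) (sm j) (W j)) (Ainf := Ginf) (Kinf := Ginf) (Sinf := Sinf)
    (Winf := Winf) (TbalOf_JsBalAtOf_codressed_unit hLc hr cE cVH cΛ W Cw' δw hδw hW' Sfl sf sm hSfl hsf hsm) hG hGinf hGrate hG hGinf hGrate
    hS hSinf hSrate hW hWinf hWrate hR hRK hRS hRW hθ0 hθ1 μ ν N

/-- [folklore] **THE WALL OVER THE ROOTED LITERAL ⟺ THE EXPLICIT IDENTIFICATION AT THE CONSTRUCTED LIMITS, CAUCHY CURRENCY, CO-DRESSED K-SLOT, ANY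
UNITS**: `j`-uniform rows + ALL-SCALES deviations with rate `θ` of `D_j G_j D_j` (`G_j = Π_ρ K_j Πᵀ_ρ`), of `unitS_j (S♭ j)`, of `unitW_j (W j)`, and
`0 ≤ θ < 1` ⟹ `D1Drift Lc (JsBalAtOf …) N μ ν ↔ secondMoment (hessKer G∞ (vertexOfK G∞ Lc S∞) W∞) μ ν = stepBal N Lc` at
`G∞ = limMKerOf (D G D)`, `S∞ = limStOf (unitS S♭)`, `W∞ = limTabOf (unitW W)`.  The binder list of `HessKerRootedWall.d1Drift_JsBalAtOf_iff_of_cauchy_unit`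
with the K-slot rows moved from `D_j K_j D_j` to `D_j (Π_ρ K_j Πᵀ_ρ) D_j` and NO dressing transport of the stencil / table rows.  NOT proved here
for Bałaban's objects; discharges NOTHING. -/
theorem d1Drift_JsBalAtOf_iff_of_cauchy_codressed_unit (hSfl : ∀ j, (JsBal0AtOf hLc hr cE cVH cΛ W Cw' δw hδw hW' j).S = Sfl j)
    (hsf : ∀ j, sf j ≠ 0) (hsm : ∀ j, sm j ≠ 0)
    (hG : ∀ j, Decays (unitK (sf j) (sm j) (coDressKAt (toSite r) Lc (KInvStep (d := 3) Lc j))) C δK)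
    (hGall : ∀ k j, Decays (unitK (sf (k + j)) (sm (k + j)) (coDressKAt (toSite r) Lc (KInvStep (d := 3) Lc (k + j))) -
      unitK (sf k) (sm k) (coDressKAt (toSite r) Lc (KInvStep (d := 3) Lc k))) (cK * θ ^ k) δK)
    (hS : ∀ j, LocStencil (unitS (sf j) (sm j) (Sfl j)) Cs δS)
    (hSall : ∀ k j, LocStencil (unitS (sf (k + j)) (sm (k + j)) (Sfl (k + j)) - unitS (sf k) (sm k) (Sfl k)) (cS * θ ^ k) δS)
    (hW : ∀ j, VertexFamily₂ (unitW (sf j) (sm j) (W j)) Lc Cw δW)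
    (hWall : ∀ k j, VertexFamily₂ (unitW (sf (k + j)) (sm (k + j)) (W (k + j)) - unitW (sf k) (sm k) (W k)) Lc (cW * θ ^ k) δW)
    (hR : 0 < R) (hRK : R < δK) (hRS : R / 2 < δS) (hRW : R < δW) (hθ0 : 0 ≤ θ) (hθ1 : θ < 1) (μ ν : Fin 4) (N : ℝ) :
    D1Drift Lc (JsBalAtOf hLc hr cE cVH cΛ W Cw' δw hδw hW') N μ ν ↔
      B12Beta.secondMoment (hessKer (limMKerOf fun j => unitK (sf j) (sm j) (coDressKAt (toSite r) Lc (KInvStep (d := 3) Lc j)))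
        (vertexOfK (limMKerOf fun j => unitK (sf j) (sm j) (coDressKAt (toSite r) Lc (KInvStep (d := 3) Lc j))) Lc
          (limStOf fun j => unitS (sf j) (sm j) (Sfl j)))
        (limTabOf fun j => unitW (sf j) (sm j) (W j))) μ ν = B12Normalization.stepBal N Lc :=
  d1Drift_JsBalAtOf_iff_of_lim_codressed_unit hLc hr cE cVH cΛ W Cw' δw hδw hW' Sfl sf sm
    (Ginf := limMKerOf fun j => unitK (sf j) (sm j) (coDressKAt (toSite r) Lc (KInvStep (d := 3) Lc j)))
    (Sinf := limStOf fun j => unitS (sf j) (sm j) (Sfl j)) (Winf := limTabOf fun j => unitW (sf j) (sm j) (W j)) hSfl hsf hsm hG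
    (decays_limMKerOf hG hGall hθ1) (decays_sub_limMKerOf hGall hθ1) hS (locStencil_limStOf hS hSall hθ1) (locStencil_sub_limStOf hSall hθ1) hW
    (vertexFamily₂_limTabOf hW hWall hθ1) (vertexFamily₂_sub_limTabOf hWall hθ1) hR hRK hRS hRW hθ0 hθ1 μ ν N

end End

/-! ## §4 The wall candidate v2.22 `SpineRooted.JsBalAn1At hLc hr` on the co-dressed resolvents -/

section WallV222

variable {Lc : ℕ} [NeZero Lc] (hLc : 1 ≤ Lc) {r : Fin (3 + 1) → ℕ} (hr : r ∈ box (3 + 1) Lc) (cE cVH cΛ cE₂ cB : ℝ)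
  (T : Fin 4 → Fin 4 → Fin 4 → Fin 4 → ℝ) (Sfl : ℕ → Fin (3 + 1) → (Fin (3 + 1) → ℤ) → MKer (3 + 1) (Fib 3))
  (Wfl : ℕ → Fin (3 + 1) → (Fin (3 + 1) → ℤ) → Fin (3 + 1) → (Fin (3 + 1) → ℤ) → MKer (3 + 1) (Fib 3)) (sf sm : ℕ → ℝ)
  {W₀ : ℕ → Fin (3 + 1) → (Fin (3 + 1) → ℤ) → Fin (3 + 1) → (Fin (3 + 1) → ℤ) → MKer (3 + 1) (Fib 3)} {Cw₀ δw₀ : ℕ → ℝ}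
  {hδw₀ : ∀ j, 0 < δw₀ j} {hW₀ : ∀ j, VertexFamily₂ (W₀ j) Lc (Cw₀ j) (δw₀ j)} {R C cK δK Cs cS δS Cw cW δW θ : ℝ}
  (hSfl : ∀ j, (JsBal0AtOf hLc hr cE cVH cΛ W₀ Cw₀ δw₀ hδw₀ hW₀ j).S = Sfl j)
  (hWfl : ∀ j, WbalAtOf 3 Lc (toSite r) cE cVH cΛ
    (T2AtOf 3 Lc (toSite r) cE cVH cΛ cE₂ cB T (vh₂SAt (toSite r) Lc) (mixFFAt (toSite r) Lc)) (mixFFAt (toSite r) Lc) j = Wfl j)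
  (hsf : ∀ j, sf j ≠ 0) (hsm : ∀ j, sm j ≠ 0)
include hSfl hWfl hsf hsm

/-- [folklore] **THE WALL CANDIDATE v2.22 ⟺ THE EXPLICIT IDENTIFICATION AT THE CONSTRUCTED LIMITS, CAUCHY CURRENCY, CO-DRESSED K-SLOT, ANY UNITS**
— §3's END at v2.22's instance (`HessKerRootedWall.JsBalAn1At_eq_JsBalAtOf`, `rfl`), for ANY presentations `S♭` of the undressed rooted stencils
(`hS♭`, against ANY table data: `JsBal0AtOf_S_indep`) and `W♭` of the tables `W♮ j := WbalAtOf 3 Lc (toSite r) … (T2AtOf …) (mixFFAt (toSite r) Lc) j`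
(`hW♭`): `j`-uniform rows + ALL-SCALES deviations with rate `θ` of the RESCALED CO-DRESSED RESOLVENTS `D_j (Π_ρ K_j Πᵀ_ρ) D_j`, of `unitS_j (S♭ j)`,
of `unitW_j (W♭ j)`, and `0 ≤ θ < 1` ⟹
`D1Drift Lc (SpineRooted.JsBalAn1At hLc hr cE cVH cΛ cE₂ cB T) N μ ν ↔ secondMoment (hessKer G∞ (vertexOfK G∞ Lc S∞) W∞) μ ν = stepBal N Lc`
at `G∞ = limMKerOf (D (Π_ρ K Πᵀ_ρ) D)`, `S∞ = limStOf (unitS S♭)`, `W∞ = limTabOf (unitW W♭)`.  It instantiates no binder at a value and discharges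
NOTHING (whether Bałaban's co-dressed resolvents satisfy the K-rows is OPEN — Q-dress / G-an2-4; the identification is O-asym1-7). -/
theorem d1Drift_JsBalAn1At_iff_of_cauchy_codressed_unit
    (hG : ∀ j, Decays (unitK (sf j) (sm j) (coDressKAt (toSite r) Lc (KInvStep (d := 3) Lc j))) C δK)
    (hGall : ∀ k j, Decays (unitK (sf (k + j)) (sm (k + j)) (coDressKAt (toSite r) Lc (KInvStep (d := 3) Lc (k + j))) -
      unitK (sf k) (sm k) (coDressKAt (toSite r) Lc (KInvStep (d := 3) Lc k))) (cK * θ ^ k) δK)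
    (hS : ∀ j, LocStencil (unitS (sf j) (sm j) (Sfl j)) Cs δS)
    (hSall : ∀ k j, LocStencil (unitS (sf (k + j)) (sm (k + j)) (Sfl (k + j)) - unitS (sf k) (sm k) (Sfl k)) (cS * θ ^ k) δS)
    (hW : ∀ j, VertexFamily₂ (unitW (sf j) (sm j) (Wfl j)) Lc Cw δW)
    (hWall : ∀ k j, VertexFamily₂ (unitW (sf (k + j)) (sm (k + j)) (Wfl (k + j)) - unitW (sf k) (sm k) (Wfl k)) Lc (cW * θ ^ k) δW)
    (hR : 0 < R) (hRK : R < δK) (hRS : R / 2 < δS) (hRW : R < δW) (hθ0 : 0 ≤ θ) (hθ1 : θ < 1) (μ ν : Fin 4) (N : ℝ) :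
    D1Drift Lc (JsBalAn1At hLc hr cE cVH cΛ cE₂ cB T) N μ ν ↔
      B12Beta.secondMoment (hessKer (limMKerOf fun j => unitK (sf j) (sm j) (coDressKAt (toSite r) Lc (KInvStep (d := 3) Lc j)))
        (vertexOfK (limMKerOf fun j => unitK (sf j) (sm j) (coDressKAt (toSite r) Lc (KInvStep (d := 3) Lc j))) Lc
          (limStOf fun j => unitS (sf j) (sm j) (Sfl j)))
        (limTabOf fun j => unitW (sf j) (sm j) (Wfl j))) μ ν = B12Normalization.stepBal N Lc := by
  obtain rfl : WbalAtOf 3 Lc (toSite r) cE cVH cΛ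
      (T2AtOf 3 Lc (toSite r) cE cVH cΛ cE₂ cB T (vh₂SAt (toSite r) Lc) (mixFFAt (toSite r) Lc)) (mixFFAt (toSite r) Lc) = Wfl :=
    funext hWfl
  rw [JsBalAn1At_eq_JsBalAtOf]
  refine d1Drift_JsBalAtOf_iff_of_cauchy_codressed_unit hLc hr cE cVH cΛ _ _ _ _ _ Sfl sf sm (fun j => ?_) hsf hsm hG hGall hS hSall hW
    hWall hR hRK hRS hRW hθ0 hθ1 μ ν N
  exact (JsBal0AtOf_S_indep hLc hr cE cVH cΛ j).trans (hSfl j)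

/-- [folklore] **THE WALL CANDIDATE v2.22 FROM THE CO-DRESSED ROWS + THE EXPLICIT IDENTIFICATION AT THE CONSTRUCTED LIMITS** ((⇐)). -/
theorem d1Drift_JsBalAn1At_of_cauchy_eq_codressed_unit
    (hG : ∀ j, Decays (unitK (sf j) (sm j) (coDressKAt (toSite r) Lc (KInvStep (d := 3) Lc j))) C δK)
    (hGall : ∀ k j, Decays (unitK (sf (k + j)) (sm (k + j)) (coDressKAt (toSite r) Lc (KInvStep (d := 3) Lc (k + j))) -
      unitK (sf k) (sm k) (coDressKAt (toSite r) Lc (KInvStep (d := 3) Lc k))) (cK * θ ^ k) δK)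
    (hS : ∀ j, LocStencil (unitS (sf j) (sm j) (Sfl j)) Cs δS)
    (hSall : ∀ k j, LocStencil (unitS (sf (k + j)) (sm (k + j)) (Sfl (k + j)) - unitS (sf k) (sm k) (Sfl k)) (cS * θ ^ k) δS)
    (hW : ∀ j, VertexFamily₂ (unitW (sf j) (sm j) (Wfl j)) Lc Cw δW)
    (hWall : ∀ k j, VertexFamily₂ (unitW (sf (k + j)) (sm (k + j)) (Wfl (k + j)) - unitW (sf k) (sm k) (Wfl k)) Lc (cW * θ ^ k) δW)
    (hR : 0 < R) (hRK : R < δK) (hRS : R / 2 < δS) (hRW : R < δW) (hθ0 : 0 ≤ θ) (hθ1 : θ < 1) (μ ν : Fin 4) {N : ℝ}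
    (hEq : B12Beta.secondMoment (hessKer (limMKerOf fun j => unitK (sf j) (sm j) (coDressKAt (toSite r) Lc (KInvStep (d := 3) Lc j)))
        (vertexOfK (limMKerOf fun j => unitK (sf j) (sm j) (coDressKAt (toSite r) Lc (KInvStep (d := 3) Lc j))) Lc
          (limStOf fun j => unitS (sf j) (sm j) (Sfl j)))
        (limTabOf fun j => unitW (sf j) (sm j) (Wfl j))) μ ν = B12Normalization.stepBal N Lc) :
    D1Drift Lc (JsBalAn1At hLc hr cE cVH cΛ cE₂ cB T) N μ ν :=
  (d1Drift_JsBalAn1At_iff_of_cauchy_codressed_unit hLc hr cE cVH cΛ cE₂ cB T Sfl Wfl sf sm hSfl hWfl hsf hsm hG hGall hS hSall hW hWall hR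
    hRK hRS hRW hθ0 hθ1 μ ν N).2 hEq

/-! ## §5 Consistency with the entrywise socket of `HessKerRootedWall` -/

/-- [folklore] **THE ENTRYWISE K-ROWS ALREADY GIVE THE CO-DRESSED IDENTIFICATION** (window `R < δK/4`): under the binder list of
`HessKerRootedWall.d1Drift_JsBalAn1At_iff_of_cauchy_unit` — rows of the RESCALED DECIMATED WEAK-LANDAU RESOLVENTS `D_j K_j D_j` themselves — the
co-dressed K-rows of §4 hold at `(c·C, δK/4, c·c_K, θ)` (`exists_coDressed_unit_rows`), hence
`D1Drift Lc (JsBalAn1At …) N μ ν ↔ secondMoment (hessKer G∞ (vertexOfK G∞ Lc S∞) W∞) μ ν = stepBal N Lc` at the CO-DRESSED constructed limit.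
(The co-dressed binders are WEAKER-OR-EQUAL to the entrywise ones; nothing here says they are strictly weaker.) -/
theorem d1Drift_JsBalAn1At_iff_codressed_of_unit_rows
    (hK : ∀ j, Decays (unitK (sf j) (sm j) (KInvStep (d := 3) Lc j)) C δK)
    (hKall : ∀ k j, Decays (unitK (sf (k + j)) (sm (k + j)) (KInvStep (d := 3) Lc (k + j)) -
      unitK (sf k) (sm k) (KInvStep (d := 3) Lc k)) (cK * θ ^ k) δK)
    (hS : ∀ j, LocStencil (unitS (sf j) (sm j) (Sfl j)) Cs δS)
    (hSall : ∀ k j, LocStencil (unitS (sf (k + j)) (sm (k + j)) (Sfl (k + j)) - unitS (sf k) (sm k) (Sfl k)) (cS * θ ^ k) δS)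
    (hW : ∀ j, VertexFamily₂ (unitW (sf j) (sm j) (Wfl j)) Lc Cw δW)
    (hWall : ∀ k j, VertexFamily₂ (unitW (sf (k + j)) (sm (k + j)) (Wfl (k + j)) - unitW (sf k) (sm k) (Wfl k)) Lc (cW * θ ^ k) δW)
    (hR : 0 < R) (hRK : R < δK / 4) (hRS : R / 2 < δS) (hRW : R < δW) (hθ0 : 0 ≤ θ) (hθ1 : θ < 1) (μ ν : Fin 4) (N : ℝ) :
    D1Drift Lc (JsBalAn1At hLc hr cE cVH cΛ cE₂ cB T) N μ ν ↔
      B12Beta.secondMoment (hessKer (limMKerOf fun j => unitK (sf j) (sm j) (coDressKAt (toSite r) Lc (KInvStep (d := 3) Lc j)))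
        (vertexOfK (limMKerOf fun j => unitK (sf j) (sm j) (coDressKAt (toSite r) Lc (KInvStep (d := 3) Lc j))) Lc
          (limStOf fun j => unitS (sf j) (sm j) (Sfl j)))
        (limTabOf fun j => unitW (sf j) (sm j) (Wfl j))) μ ν = B12Normalization.stepBal N Lc := by
  have hδK : 0 < δK := by linarith
  obtain ⟨c, -, hG, hGall⟩ :=
    exists_coDressed_unit_rows hLc hr sf sm hsf hsm (K := fun j => KInvStep (d := 3) Lc j) hδK hK hKall
  exact d1Drift_JsBalAn1At_iff_of_cauchy_codressed_unit hLc hr cE cVH cΛ cE₂ cB T Sfl Wfl sf sm hSfl hWfl hsf hsm hG hGall hS hSall hW hWall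
    hR hRK hRS hRW hθ0 hθ1 μ ν N

/-- [folklore] **UNDER THE ENTRYWISE ROWS THE TWO CONSTRUCTED IDENTIFICATIONS HAVE THE SAME TRUTH VALUE** (window `R < δK/4`): the
identification at the dressed entrywise limit objects of `HessKerRootedWall` (`hessKer K∞ (vertexOfK K∞ Lc (𝔇_ρ S∞)) (𝔇_ρ W∞)`) holds iff the one
at the co-dressed limit objects of §4 (`hessKer G∞ (vertexOfK G∞ Lc S∞) W∞`) does — both are equivalent to the wall. -/
theorem codressed_eq_iff_dressed_eq_of_unit_rows
    (hK : ∀ j, Decays (unitK (sf j) (sm j) (KInvStep (d := 3) Lc j)) C δK)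
    (hKall : ∀ k j, Decays (unitK (sf (k + j)) (sm (k + j)) (KInvStep (d := 3) Lc (k + j)) -
      unitK (sf k) (sm k) (KInvStep (d := 3) Lc k)) (cK * θ ^ k) δK)
    (hS : ∀ j, LocStencil (unitS (sf j) (sm j) (Sfl j)) Cs δS)
    (hSall : ∀ k j, LocStencil (unitS (sf (k + j)) (sm (k + j)) (Sfl (k + j)) - unitS (sf k) (sm k) (Sfl k)) (cS * θ ^ k) δS)
    (hW : ∀ j, VertexFamily₂ (unitW (sf j) (sm j) (Wfl j)) Lc Cw δW)
    (hWall : ∀ k j, VertexFamily₂ (unitW (sf (k + j)) (sm (k + j)) (Wfl (k + j)) - unitW (sf k) (sm k) (Wfl k)) Lc (cW * θ ^ k) δW)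
    (hR : 0 < R) (hRK : R < δK / 4) (hRS : R / 2 < δS) (hRW : R < δW) (hθ0 : 0 ≤ θ) (hθ1 : θ < 1) (μ ν : Fin 4) (N : ℝ) :
    B12Beta.secondMoment (hessKer (limMKerOf fun j => unitK (sf j) (sm j) (coDressKAt (toSite r) Lc (KInvStep (d := 3) Lc j)))
        (vertexOfK (limMKerOf fun j => unitK (sf j) (sm j) (coDressKAt (toSite r) Lc (KInvStep (d := 3) Lc j))) Lc
          (limStOf fun j => unitS (sf j) (sm j) (Sfl j)))
        (limTabOf fun j => unitW (sf j) (sm j) (Wfl j))) μ ν = B12Normalization.stepBal N Lc ↔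
      B12Beta.secondMoment (hessKer (limMKerOf fun j => unitK (sf j) (sm j) (KInvStep (d := 3) Lc j))
        (vertexOfK (limMKerOf fun j => unitK (sf j) (sm j) (KInvStep (d := 3) Lc j)) Lc fun κ u => dressKAt (toSite r) Lc
          (coProjAtK (toSite r) Lc (limStOf fun j => unitS (sf j) (sm j) (Sfl j)) κ u))
        fun μ y ν y' => dressKAt (toSite r) Lc (limTabOf (fun j => unitW (sf j) (sm j) (Wfl j)) μ y ν y')) μ ν =
        B12Normalization.stepBal N Lc := by
  have hRK' : R < δK := by linarith
  exact (d1Drift_JsBalAn1At_iff_codressed_of_unit_rows hLc hr cE cVH cΛ cE₂ cB T Sfl Wfl sf sm hSfl hWfl hsf hsm hK hKall hS hSall hW hWall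
      hR hRK hRS hRW hθ0 hθ1 μ ν N).symm.trans
    (d1Drift_JsBalAn1At_iff_of_cauchy_unit hLc hr cE cVH cΛ cE₂ cB T Sfl Wfl sf sm hSfl hWfl hsf hsm hK hKall hS hSall hW hWall hR hRK' hRS
      hRW hθ0 hθ1 μ ν N)

end WallV222

end

end Summit.QuantumFields.BalabanUV.Beta.HessKerCoDressedWall
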